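import Literature.Topology.FourManifolds.CentreFlatReduction
import HarnessLib

/-!
# The Jacobian determinant of a diffeomorphism which is the identity near one point is positive

Topic `Literature/Topology/FourManifolds`; a proofs-only file (no definitions, no named facts), a
companion of `CentreFlatReduction.lean`, §2 (`Diffeomorph.det_fderiv_ne_zero`,
`Diffeomorph.det_fderiv_pos_of_forall_le_norm`: the identity OFF A BALL ⇒ positive Jacobian) and
of `CerfPropositionFourProofs.lean` (`Diffeomorph.hasFDerivAt_coe`, the chain rules).  Here the
hypothesis is local: **a diffeomorphism `φ` of a finite-dimensional real normed space which agrees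
with the identity on a neighbourhood of some point has `det Dφ(x) > 0` at every point**
(`Diffeomorph.det_fderiv_pos_of_eventuallyEq_id`, `Diffeomorph.det_fderiv_pos_of_eqOn`):
`x ↦ det Dφ(x)` is continuous, never zero, equal to `1` at the given point, hence positive on the
connected space.  Also the product rule `det D(ψ ∘ φ)(x) = det Dψ(φ x) · det Dφ(x)`
(`Diffeomorph.det_fderiv_trans`), so that orientation-preservation passes to composites
(`Diffeomorph.det_fderiv_trans_pos`).

Use: the page-preserving identification `Φ = Φ₂ ∘ Φ₁` of the Lefschetz base with its rounded
convex model (`LefschetzBaseModelIdentification.lean`) is orientation preserving — the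
orientation clause of `palf_stein_supportedByBoundaryOpenBook_of_reebModels`.

## References

* J. Milnor, *Topology from the Differentiable Viewpoint* (1965), §6 (isotopies and
  orientation). [MilnorTDV1965]
-/

noncomputable section

open scoped Manifold ContDiff Topology
open Set Function Filter

namespace Literature.Topology.FourManifolds

variable {E : Type*} [NormedAddCommGroup E] [NormedSpace ℝ E]

/-- **Chain rule for diffeomorphisms**: `D(ψ ∘ φ)(x) = Dψ(φ x) ∘ Dφ(x)`. [folklore] -/
theorem Diffeomorph.fderiv_trans (φ ψ : E ≃ₘ⟮𝓘(ℝ, E), 𝓘(ℝ, E)⟯ E) (x : E) :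
    fderiv ℝ (φ.trans ψ) x = (fderiv ℝ ψ (φ x)).comp (fderiv ℝ φ x) := by
  have h : HasFDerivAt (ψ ∘ φ) ((fderiv ℝ ψ (φ x)).comp (fderiv ℝ φ x)) x :=
    (Diffeomorph.hasFDerivAt_coe ψ (φ x)).comp x (Diffeomorph.hasFDerivAt_coe φ x)
  exact h.fderiv

/-- **`det D(ψ ∘ φ)(x) = det Dψ(φ x) · det Dφ(x)`.** [folklore] -/
theorem Diffeomorph.det_fderiv_trans (φ ψ : E ≃ₘ⟮𝓘(ℝ, E), 𝓘(ℝ, E)⟯ E) (x : E) :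
    LinearMap.det (fderiv ℝ (φ.trans ψ) x : E →ₗ[ℝ] E) =
      LinearMap.det (fderiv ℝ ψ (φ x) : E →ₗ[ℝ] E) * LinearMap.det (fderiv ℝ φ x : E →ₗ[ℝ] E) := by
  rw [Diffeomorph.fderiv_trans]
  exact LinearMap.det_comp (fderiv ℝ ψ (φ x) : E →ₗ[ℝ] E) (fderiv ℝ φ x : E →ₗ[ℝ] E)

/-- **Composites of orientation-preserving diffeomorphisms are orientation preserving.**
[folklore] -/
theorem Diffeomorph.det_fderiv_trans_pos {φ ψ : E ≃ₘ⟮𝓘(ℝ, E), 𝓘(ℝ, E)⟯ E}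
    (hφ : ∀ x, 0 < LinearMap.det (fderiv ℝ φ x : E →ₗ[ℝ] E))
    (hψ : ∀ x, 0 < LinearMap.det (fderiv ℝ ψ x : E →ₗ[ℝ] E)) (x : E) :
    0 < LinearMap.det (fderiv ℝ (φ.trans ψ) x : E →ₗ[ℝ] E) := by
  rw [Diffeomorph.det_fderiv_trans]
  exact mul_pos (hψ _) (hφ _)

variable [FiniteDimensional ℝ E]

/-- **A diffeomorphism which is the identity near one point has everywhere positive Jacobian
determinant**: `y ↦ det Dφ(y)` is continuous, never zero (`Diffeomorph.det_fderiv_ne_zero`), and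
equals `1` at `x₀`, so it is positive by the intermediate value theorem on the connected space `E`
(Milnor 1965, §6). [cite: MilnorTDV1965, §6] -/
theorem Diffeomorph.det_fderiv_pos_of_eventuallyEq_id (φ : E ≃ₘ⟮𝓘(ℝ, E), 𝓘(ℝ, E)⟯ E) {x₀ : E}
    (hφ : (φ : E → E) =ᶠ[𝓝 x₀] id) (x : E) :
    0 < LinearMap.det (fderiv ℝ φ x : E →ₗ[ℝ] E) := by
  have hφc : ContDiff ℝ ∞ (φ : E → E) := contMDiff_iff_contDiff.mp φ.contMDiff
  have hcont : Continuous fun y => LinearMap.det (fderiv ℝ φ y : E →ₗ[ℝ] E) :=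
    ContinuousLinearMap.continuous_det.comp (hφc.continuous_fderiv (by simp))
  have hx₀d : LinearMap.det (fderiv ℝ φ x₀ : E →ₗ[ℝ] E) = 1 := by
    rw [hφ.fderiv_eq, fderiv_id]
    exact LinearMap.det_id
  by_contra hx
  push Not at hx
  obtain ⟨z, hz⟩ := intermediate_value_univ x x₀ hcont ⟨hx, by rw [hx₀d]; exact zero_le_one⟩
  exact Diffeomorph.det_fderiv_ne_zero φ z hz

/-- **Orientation-preservation from an open set of fixed points**: if `φ y = y` for all `y` in
an open set containing `x₀`, then `det Dφ > 0` everywhere. [cite: MilnorTDV1965, §6] -/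
theorem Diffeomorph.det_fderiv_pos_of_eqOn (φ : E ≃ₘ⟮𝓘(ℝ, E), 𝓘(ℝ, E)⟯ E) {U : Set E}
    (hU : IsOpen U) {x₀ : E} (hx₀ : x₀ ∈ U) (hφ : ∀ y ∈ U, φ y = y) (x : E) :
    0 < LinearMap.det (fderiv ℝ φ x : E →ₗ[ℝ] E) :=
  Diffeomorph.det_fderiv_pos_of_eventuallyEq_id φ
    (by filter_upwards [hU.mem_nhds hx₀] with y hy using hφ y hy) x

end Literature.Topology.FourManifolds

end
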